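import Summits.QuantumFields.YangMills.Theorems.ColdStartUniversalityLindebergSwapSmallFieldContinuity
import Summits.QuantumFields.YangMills.Theorems.ColdStartUniversalityLatticeLangevinGaugeCovarianceLaw
import Literature.MathematicalPhysics.QuantumFieldTheory.Balaban1983to89.T4AvgDerivBound
import HarnessLib

/-!
# Route `ColdStartUniversality`, LINE 3 «lindeberg_swap» (crux K_A2 `ColdStartContinuumCauchy`, stmt-QuantumFields-24810):
# the scale-weighted Lipschitz class `𝒢_K(A)` consists of GAUGE-INVARIANT observables, and the SZZ semigroup keeps them
# gauge invariant

Helper file (seat `ym-line-csu-p1`, g11, free hands; `--supports stmt-QuantumFields-24810`).  The two open XL stubs of the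
line, `stub_scalePropagation` («`P_s` maps `𝒢_K(A)` into `𝒢_K(C_T A)`») and `stub_oneWindowSwap`, are stated in the currency
`wd_K = Σ_j L^{-(K-j)} discG_j` (block averages compared MODULO depth-`j` gauge transformations).  This file records the
gauge-theoretic consistency of that currency with the dynamics, combining Bałaban's covariance of the averaging operations
(`Averaging.covariant`) with the gauge covariance in law of the SZZ dynamics landed in `…GaugeCovarianceLaw`:

* `toField_gaugeTransform` — reading a configuration as a level-0 field intertwines the lattice gauge action
  `gaugeTransform h` (tree `ConstructiveQFTWave0`) with Bałaban's `GaugeField.gaugeAct h`;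
* `iter_gaugeAct` — iterated averagings are covariant: `M^j(U^h) = (M^j U)^{h_j}` for some depth-`j` transformation `h_j`
  (induction on `Averaging.covariant`, `j ≤ m + K`); `avgField_gaugeTransform` — the same for `avgField`;
* ★ `discG_gaugeTransform_right/left`, `wdisc_gaugeTransform_right/left` — the currency does not see gauge copies:
  `discG_j(u, h·u) = 0 = discG_j(h·u, u)`, `wd_K(u, h·u) = 0 = wd_K(h·u, u)`;
* ★ `isGaugeInvariant_of_inCls` — every `g ∈ 𝒢_K(A)` is gauge invariant;
* ★ `isGaugeInvariant_markovTransition_of_inCls` — for every jointly measurable solution family `V` of the step-`K` dynamics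
  and `g ∈ 𝒢_K(A)`, `P_t g = markovTransition V P t g` is gauge invariant (the `A`-independent, necessary half of the
  conclusion `P_s g ∈ 𝒢_K(C A)` of `ScalePropagation`; from `GaugeCovariance.isGaugeInvariant_markovTransition`).

THEOREMS ONLY, [folklore] / [cite: Balaban1985Averaging, (11) p.19] for the covariance of the averages; the XL stubs are NOT
proved; no crux or summit is proved; the Yang–Mills mass gap is NOT proved.
-/

set_option autoImplicit false

noncomputable section

namespace Summit.QuantumFields.YangMills.Cruxes.ColdStartContinuumCauchy.LindebergSwap

open MeasureTheory ProbabilityTheory Filter Set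
open scoped NNReal ENNReal BigOperators
open Literature.MathematicalPhysics.QuantumFieldTheory
open Literature.MathematicalPhysics.QuantumFieldTheory.Balaban1983to89
open Literature.MathematicalPhysics.QuantumLattice

/-! ## Covariance of iterated averagings (general) -/

section Covariance

variable {P : Params} {G : Type*} [GaugeGroup G]

/-- ★ **Iterated averagings are gauge covariant**: for `j ≤ m + K` there is a depth-`j` gauge transformation `h_j` (the iterated
restriction of `h` along `emb`) with `M^j(U^h) = (M^j U)^{h_j}`. [cite: Balaban1985Averaging, (11) p.19] -/
theorem iter_gaugeAct (av : ∀ j, Averaging P j G) (h : GaugeTransf P 0 G) (U : GaugeField P 0 G) :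
    ∀ j : ℕ, j ≤ P.m + P.K → ∃ hj : GaugeTransf P j G,
      Averaging.iter av j (GaugeField.gaugeAct h U) = GaugeField.gaugeAct hj (Averaging.iter av j U)
  | 0, _ => ⟨h, rfl⟩
  | j + 1, hle => by
      obtain ⟨hj, e⟩ := iter_gaugeAct av h U j (by omega)
      refine ⟨fun y => hj (emb y), ?_⟩
      show (av j).avg (Averaging.iter av j (GaugeField.gaugeAct h U)) =
        GaugeField.gaugeAct (fun y => hj (emb y)) ((av j).avg (Averaging.iter av j U))
      rw [e, (av j).covariant (by omega)]

end Covariance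

/-! ## The currency and the lattice gauge action -/

section Currency

variable (F : T3ContinuumYM3Torus.T3Family)

/-- The two conventions for `x + e_i` agree: `x + δ_i = update x i (x i + 1)`. [folklore] -/
theorem add_single_eq_update {n d : ℕ} (x : Fin d → ZMod n) (i : Fin d) :
    x + Pi.single i 1 = Function.update x i (x i + 1) := by
  funext j
  by_cases hji : j = i
  · subst hji
    simp
  · simp [Pi.single_eq_of_ne hji, Function.update_of_ne hji]

/-- ★ **`toField` intertwines the two gauge actions**: `toField (h·c) = (toField c)^h`. [folklore] -/
theorem toField_gaugeTransform (K : ℕ) (h : Site (F.P K) 0 → G2) (c : GaugeConfig 3 ((F.P K).sitesPerDir 0) G2) :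
    toField F K (gaugeTransform h c) = GaugeField.gaugeAct h (toField F K c) := by
  funext b
  simp only [toField, gaugeTransform, GaugeField.gaugeAct, PBond.tgt, Literature.MathematicalPhysics.QuantumFieldTheory.Site.shift,
    Balaban1983to89.Site.shift]
  congr 3
  exact add_single_eq_update _ _

/-- ★ **Block averages of a gauge copy are a gauge copy of the block averages** (`j ≤ m + K`). [cite: Balaban1985Averaging, (11) p.19] -/
theorem avgField_gaugeTransform (K j : ℕ) (hj : j ≤ (F.P K).m + (F.P K).K) (h : Site (F.P K) 0 → G2)
    (c : GaugeConfig 3 ((F.P K).sitesPerDir 0) G2) :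
    ∃ hj' : GaugeTransf (F.P K) j G2, avgField F K j (gaugeTransform h c) = GaugeField.gaugeAct hj' (avgField F K j c) := by
  unfold avgField
  rw [toField_gaugeTransform]
  exact iter_gaugeAct (P := F.P K) (fun i => BlockAveraging.blockAvg (P := F.P K) (j := i) avSU) h (toField F K c) j hj

/-- `discG_j ≥ 0`. [folklore] -/
theorem discG_nonneg (K j : ℕ) (u v : GaugeConfig 3 ((F.P K).sitesPerDir 0) G2) : 0 ≤ discG F K j u v :=
  Real.iInf_nonneg fun _ => Summit.QuantumFields.YangMills.Cruxes.WeightedAlmostInvariance.SynchronousShadow.fieldDistAt_nonneg F K j _ _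

/-- Depths `j ≤ K` are within Bałaban's standing range `j ≤ m + K`. [folklore] -/
theorem depth_le (K j : ℕ) (hj : j ≤ K) : j ≤ (F.P K).m + (F.P K).K := by
  show j ≤ F.m + K
  omega

/-- ★ **The depth-`j` discrepancy does not see gauge copies (right)**: `discG_j(u, h·u) = 0` for `j ≤ K`. [folklore] -/
theorem discG_gaugeTransform_right (K j : ℕ) (hj : j ≤ K) (h : Site (F.P K) 0 → G2)
    (u : GaugeConfig 3 ((F.P K).sitesPerDir 0) G2) : discG F K j u (gaugeTransform h u) = 0 := by
  obtain ⟨hj', e⟩ := avgField_gaugeTransform F K j (depth_le F K j hj) h u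
  refine le_antisymm ?_ (discG_nonneg F K j _ _)
  calc discG F K j u (gaugeTransform h u)
      ≤ fieldDistAt F K j (avgField F K j u)
          (GaugeField.gaugeAct (fun y => (hj' y)⁻¹) (avgField F K j (gaugeTransform h u))) :=
        ciInf_le ⟨0, by rintro _ ⟨g, rfl⟩; exact Summit.QuantumFields.YangMills.Cruxes.WeightedAlmostInvariance.SynchronousShadow.fieldDistAt_nonneg F K j _ _⟩ _
    _ = 0 := by rw [e, T4AvgDerivBound.gaugeAct_inv_gaugeAct, fieldDistAt_self]

/-- ★ **The depth-`j` discrepancy does not see gauge copies (left)**: `discG_j(h·u, u) = 0` for `j ≤ K`. [folklore] -/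
theorem discG_gaugeTransform_left (K j : ℕ) (hj : j ≤ K) (h : Site (F.P K) 0 → G2)
    (u : GaugeConfig 3 ((F.P K).sitesPerDir 0) G2) : discG F K j (gaugeTransform h u) u = 0 := by
  obtain ⟨hj', e⟩ := avgField_gaugeTransform F K j (depth_le F K j hj) h u
  refine le_antisymm ?_ (discG_nonneg F K j _ _)
  calc discG F K j (gaugeTransform h u) u
      ≤ fieldDistAt F K j (avgField F K j (gaugeTransform h u)) (GaugeField.gaugeAct hj' (avgField F K j u)) :=
        ciInf_le ⟨0, by rintro _ ⟨g, rfl⟩; exact Summit.QuantumFields.YangMills.Cruxes.WeightedAlmostInvariance.SynchronousShadow.fieldDistAt_nonneg F K j _ _⟩ _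
    _ = 0 := by rw [e, fieldDistAt_self]

/-- ★ **`wd_K(u, h·u) = 0`.** [folklore] -/
theorem wdisc_gaugeTransform_right (K : ℕ) (h : Site (F.P K) 0 → G2) (u : GaugeConfig 3 ((F.P K).sitesPerDir 0) G2) :
    wdisc F K u (gaugeTransform h u) = 0 := by
  unfold wdisc
  refine Finset.sum_eq_zero fun j hj => ?_
  rw [discG_gaugeTransform_right F K j (Nat.lt_succ_iff.mp (Finset.mem_range.mp hj)) h u, mul_zero]

/-- ★ **`wd_K(h·u, u) = 0`.** [folklore] -/
theorem wdisc_gaugeTransform_left (K : ℕ) (h : Site (F.P K) 0 → G2) (u : GaugeConfig 3 ((F.P K).sitesPerDir 0) G2) :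
    wdisc F K (gaugeTransform h u) u = 0 := by
  unfold wdisc
  refine Finset.sum_eq_zero fun j hj => ?_
  rw [discG_gaugeTransform_left F K j (Nat.lt_succ_iff.mp (Finset.mem_range.mp hj)) h u, mul_zero]

/-- ★ **Every observable of the scale-weighted Lipschitz class is gauge invariant**: `g ∈ 𝒢_K(A) ⇒ g(h·u) = g(u)`
(`|g(h·u) − g(u)| ≤ A · wd_K(h·u, u) = 0`). [folklore] -/
theorem isGaugeInvariant_of_inCls (K : ℕ) {A : ℝ} {g : GaugeConfig 3 ((F.P K).sitesPerDir 0) G2 → ℝ}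
    (hg : InCls F K A g) : IsGaugeInvariant g := by
  intro h u
  have h1 := hg.2.2 (gaugeTransform h u) u
  rw [wdisc_gaugeTransform_left, mul_zero] at h1
  exact sub_eq_zero.mp (abs_nonpos_iff.mp h1)

end Currency

/-! ## The semigroup keeps the class gauge invariant -/

section Semigroup

variable (F : T3ContinuumYM3Torus.T3Family)

/-- ★ **`P_t g` is gauge invariant for `g ∈ 𝒢_K(A)`**: for every jointly measurable strong-solution family `V` of the step-`K`
SZZ dynamics (one probability space, one flat driver), every `g ∈ 𝒢_K(A)` and every lattice time `t`,
`markovTransition V P t g (h·x) = markovTransition V P t g x` — the necessary, `A`-independent half of `P_s g ∈ 𝒢_K(C A)`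
(`ScalePropagation`), from the gauge covariance in law of the dynamics (`GaugeCovariance.isGaugeInvariant_markovTransition`)
and `isGaugeInvariant_of_inCls`. [folklore] -/
theorem isGaugeInvariant_markovTransition_of_inCls (γ : ℝ) (K : ℕ)
    {Ω : Type} {mΩ : MeasurableSpace Ω} {P : Measure Ω} [IsProbabilityMeasure P]
    {W : ℝ≥0 → Ω → (Edge 3 ((F.P K).sitesPerDir 0) × NoiseIdx 2 → ℝ)} {hW : IsFlatBrownian W P}
    {V : GaugeConfig 3 ((F.P K).sitesPerDir 0) G2 → ℝ≥0 → Ω → GaugeConfig 3 ((F.P K).sitesPerDir 0) G2}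
    (hV : IsSolFamily F γ K P W hW V) {A : ℝ} {g : GaugeConfig 3 ((F.P K).sitesPerDir 0) G2 → ℝ} (hg : InCls F K A g)
    (t : ℝ≥0) : IsGaugeInvariant (markovTransition V P t g) :=
  Summit.QuantumFields.YangMills.Theorems.ColdStartUniversality.GaugeCovariance.isGaugeInvariant_markovTransition
    ((γ * (F.P K).eps)⁻¹ / 2) hW hV.1 hg.1 (isGaugeInvariant_of_inCls F K hg) t

/-- **Consequently `P_t g` also annihilates the gauge directions of the currency**: `|P_t g (u) − P_t g (h·u)| = 0 ≤ A' · wd_K`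
for any `A' ≥ 0` — on gauge copies the Lipschitz requirement of `𝒢_K(A')` is met trivially. [folklore] -/
theorem abs_markovTransition_sub_gaugeTransform (γ : ℝ) (K : ℕ)
    {Ω : Type} {mΩ : MeasurableSpace Ω} {P : Measure Ω} [IsProbabilityMeasure P]
    {W : ℝ≥0 → Ω → (Edge 3 ((F.P K).sitesPerDir 0) × NoiseIdx 2 → ℝ)} {hW : IsFlatBrownian W P}
    {V : GaugeConfig 3 ((F.P K).sitesPerDir 0) G2 → ℝ≥0 → Ω → GaugeConfig 3 ((F.P K).sitesPerDir 0) G2}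
    (hV : IsSolFamily F γ K P W hW V) {A : ℝ} {g : GaugeConfig 3 ((F.P K).sitesPerDir 0) G2 → ℝ} (hg : InCls F K A g)
    (t : ℝ≥0) (h : Site (F.P K) 0 → G2) (u : GaugeConfig 3 ((F.P K).sitesPerDir 0) G2) {A' : ℝ} (hA' : 0 ≤ A') :
    |markovTransition V P t g u - markovTransition V P t g (gaugeTransform h u)| ≤ A' * wdisc F K u (gaugeTransform h u) := by
  rw [isGaugeInvariant_markovTransition_of_inCls F γ K hV hg t h u, sub_self, abs_zero]
  exact mul_nonneg hA' (wdisc_nonneg_le_four F K _ _).1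

end Semigroup

end Summit.QuantumFields.YangMills.Cruxes.ColdStartContinuumCauchy.LindebergSwap

end
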